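import Literature.NumberTheory.Automorphic.GLnGelfandKazhdanInvolution
import HarnessLib

/-!
# The big Bruhat cell of `GL_n` over a commutative ring: the chart `(X₁, a, X₂) ↦ (1 + X₁) w⁰ a (1 + X₂)`

Topic `NumberTheory/Automorphic`; namespace `Literature.NumberTheory.Automorphic`. Algebraic part of the
chart of the big cell `Ω = N w⁰ A N ⊂ GL_n(R)` used for the archimedean Gelfand–Kazhdan symmetry on the
big cell (`R = K_∞ = K ⊗ ℝ`, a product of copies of `ℝ` and `ℂ`, is not a field, so the Bruhat
decomposition of `OpenBruhatCellGL` over fields is redone here in the generality of a commutative ring):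

* `strictUpper n R` — the strictly upper triangular matrices (`X i j = 0` for `j ≤ i`), nilpotent:
  `X ^ n = 0` (`strictUpper_pow_eq_zero`); `unitri X = 1 + X ∈ GL_n(R)` with inverse `Σ_{k<n} (-X)^k`,
  a member of `upperUnitriangular` (`unitri_mem_upperUnitriangular`), and conversely;
* `bigCellMap X₁ a X₂ = (1 + X₁) w⁰ diag(a) (1 + X₂)`;
* `bigCellMap_injective` — **uniqueness of the Bruhat decomposition in the big cell** over any
  commutative ring: for strictly upper `X₁, X₁', X₂, X₂'` and unit diagonals `a, a'`,
  `(1 + X₁) w⁰ a (1 + X₂) = (1 + X₁') w⁰ a' (1 + X₂') ⟹ X₁ = X₁' ∧ a = a' ∧ X₂ = X₂'`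
  (`w⁰ U w⁰` is lower unitriangular for `U` upper unitriangular, and a matrix which is both lower
  unitriangular and upper triangular is `1`);
* `gkInvolution_bigCellMap` — `ι((1 + X₁) w⁰ a (1 + X₂)) = (1 + X₂♯) w⁰ a (1 + X₁♯)` with
  `X♯ = w⁰ ᵗX w⁰` (`ι(g) = w⁰ ᵗg w⁰`, `ᵗw⁰ = w⁰ = (w⁰)⁻¹`, `ᵗ diag = diag`): the Gelfand–Kazhdan involution
  in the coordinates of the big cell swaps the two unipotent coordinates (up to `♯`) and fixes the torus.

Everything is proved; no named fact is introduced.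

## References

* J. A. Shalika, *The multiplicity one theorem for `GL_n`*, Ann. of Math. 100 (1974), §2 [Shalika1974].
* D. Bump, *Automorphic Forms and Representations* (1997), §4.4, proof of Thm. 4.4.2 (the big cell for
  `GL(2)`) [Bump1997].
-/

open Matrix

namespace Literature.NumberTheory.Automorphic

variable {n : ℕ} {R : Type*} [CommRing R]

/-! ### 1. Strictly upper triangular matrices and the unipotent elements `1 + X` -/

section StrictUpper

variable (n R)

/-- **Strictly upper triangular matrices** `𝔫 = {X : X i j = 0 for j ≤ i}`, an `R`-submodule of
`M_n(R)`. [folklore] -/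
def strictUpper : Submodule R (Matrix (Fin n) (Fin n) R) where
  carrier := {X | ∀ i j : Fin n, j ≤ i → X i j = 0}
  zero_mem' := fun _ _ _ => rfl
  add_mem' hX hY i j hij := by simp [hX i j hij, hY i j hij]
  smul_mem' c X hX i j hij := by simp [hX i j hij]

variable {n R}

/-- Membership in `strictUpper`. [folklore] -/
theorem mem_strictUpper {X : Matrix (Fin n) (Fin n) R} : X ∈ strictUpper n R ↔ ∀ i j : Fin n, j ≤ i → X i j = 0 :=
  Iff.rfl

/-- Entries of a product with a strictly upper factor: `(X * Y) i j = 0` unless `i < k < j` contributes;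
in particular `X * Y` is strictly upper when `X` is strictly upper and `Y` is upper triangular
(`Y i j = 0` for `j < i`). [folklore] -/
theorem strictUpper_mul_upper {X Y : Matrix (Fin n) (Fin n) R} (hX : X ∈ strictUpper n R)
    (hY : ∀ i j : Fin n, j < i → Y i j = 0) : X * Y ∈ strictUpper n R := by
  intro i j hij
  rw [Matrix.mul_apply]
  refine Finset.sum_eq_zero fun k _ => ?_
  by_cases hk : k ≤ i
  · rw [hX i k hk, zero_mul]
  · rw [hY k j (lt_of_le_of_lt hij (lt_of_not_ge hk)), mul_zero]

/-- `Y * X` is strictly upper when `X` is strictly upper and `Y` is upper triangular. [folklore] -/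
theorem upper_mul_strictUpper {X Y : Matrix (Fin n) (Fin n) R} (hX : X ∈ strictUpper n R)
    (hY : ∀ i j : Fin n, j < i → Y i j = 0) : Y * X ∈ strictUpper n R := by
  intro i j hij
  rw [Matrix.mul_apply]
  refine Finset.sum_eq_zero fun k _ => ?_
  by_cases hk : j ≤ k
  · rw [hX k j hk, mul_zero]
  · rw [hY i k (lt_of_lt_of_le (lt_of_not_ge hk) hij), zero_mul]

/-- A strictly upper matrix is upper triangular. [folklore] -/
theorem upper_of_strictUpper {X : Matrix (Fin n) (Fin n) R} (hX : X ∈ strictUpper n R) :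
    ∀ i j : Fin n, j < i → X i j = 0 := fun i j h => hX i j h.le

/-- Products of strictly upper matrices are strictly upper. [folklore] -/
theorem strictUpper_mul {X Y : Matrix (Fin n) (Fin n) R} (hX : X ∈ strictUpper n R) (hY : Y ∈ strictUpper n R) :
    X * Y ∈ strictUpper n R :=
  strictUpper_mul_upper hX (upper_of_strictUpper hY)

/-- **Band vanishing of powers**: `(X ^ k) i j = 0` whenever `j < i + k` (as naturals), for strictly upper `X`.
[folklore] -/
theorem strictUpper_pow_apply_eq_zero {X : Matrix (Fin n) (Fin n) R} (hX : X ∈ strictUpper n R) :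
    ∀ (k : ℕ) (i j : Fin n), (j : ℕ) < i + k → (X ^ k) i j = 0 := by
  intro k
  induction k with
  | zero =>
    intro i j h
    rw [pow_zero, Matrix.one_apply, if_neg]
    intro hij; subst hij; omega
  | succ k ih =>
    intro i j h
    rw [pow_succ, Matrix.mul_apply]
    refine Finset.sum_eq_zero fun l _ => ?_
    by_cases hl : (l : ℕ) < i + k
    · rw [ih i l hl, zero_mul]
    · have hjl : j ≤ l := by
        rw [Fin.le_iff_val_le_val]; omega
      rw [hX l j hjl, mul_zero]

/-- **Strictly upper matrices are nilpotent**: `X ^ n = 0`. [folklore] -/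
theorem strictUpper_pow_eq_zero {X : Matrix (Fin n) (Fin n) R} (hX : X ∈ strictUpper n R) : X ^ n = 0 := by
  ext i j
  exact strictUpper_pow_apply_eq_zero hX n i j (by omega)

/-- `Σ_{k<n} (-X)^k * (1 + X) = 1`. [folklore] -/
theorem geom_mul_one_add_eq_one {X : Matrix (Fin n) (Fin n) R} (hX : X ∈ strictUpper n R) :
    (∑ k ∈ Finset.range n, (-X) ^ k) * (1 + X) = 1 := by
  have hnil : (-X) ^ n = 0 := by
    rw [neg_pow, strictUpper_pow_eq_zero hX, mul_zero]
  have h := geom_sum_mul_neg (-X) n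
  rw [hnil, sub_zero, sub_neg_eq_add] at h
  exact h

/-- The geometric series inverse of `1 + X`: `(1 + X) * Σ_{k<n} (-X)^k = 1`. [folklore] -/
theorem one_add_mul_geom_eq_one {X : Matrix (Fin n) (Fin n) R} (hX : X ∈ strictUpper n R) :
    (1 + X) * (∑ k ∈ Finset.range n, (-X) ^ k) = 1 := by
  have hc : Commute (1 + X) (∑ k ∈ Finset.range n, (-X) ^ k) :=
    Commute.sum_right _ _ _ fun k _ =>
      (Commute.one_left _).add_left ((Commute.refl X).neg_right.pow_right k)
  rw [hc.eq]
  exact geom_mul_one_add_eq_one hX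

/-- **The unipotent element `1 + X ∈ GL_n(R)`** of a strictly upper `X`. [folklore] -/
def unitri (X : Matrix (Fin n) (Fin n) R) (hX : X ∈ strictUpper n R) : GL (Fin n) R :=
  ⟨1 + X, ∑ k ∈ Finset.range n, (-X) ^ k, one_add_mul_geom_eq_one hX, geom_mul_one_add_eq_one hX⟩

/-- The matrix of `unitri X` is `1 + X`. [folklore] -/
@[simp] theorem coe_unitri (X : Matrix (Fin n) (Fin n) R) (hX : X ∈ strictUpper n R) :
    ((unitri X hX : GL (Fin n) R) : Matrix (Fin n) (Fin n) R) = 1 + X := rfl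

/-- `1 + X` is upper unitriangular. [folklore] -/
theorem unitri_mem_upperUnitriangular (X : Matrix (Fin n) (Fin n) R) (hX : X ∈ strictUpper n R) :
    unitri X hX ∈ upperUnitriangular (Fin n) R := by
  rw [mem_upperUnitriangular_iff, coe_unitri]
  refine ⟨fun i j hij => ?_, fun i => ?_⟩
  · -- `BlockTriangular id`: entries with `j < i` vanish
    have hij' : j < i := hij
    rw [Matrix.add_apply, Matrix.one_apply, if_neg (show i ≠ j from ne_of_gt hij'), hX i j hij'.le, add_zero]
  · rw [Matrix.add_apply, Matrix.one_apply_eq, hX i i le_rfl, add_zero]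

/-- Conversely, `u - 1` is strictly upper for `u` upper unitriangular. [folklore] -/
theorem sub_one_mem_strictUpper {u : GL (Fin n) R} (hu : u ∈ upperUnitriangular (Fin n) R) :
    (u : Matrix (Fin n) (Fin n) R) - 1 ∈ strictUpper n R := by
  rw [mem_upperUnitriangular_iff] at hu
  intro i j hij
  rw [Matrix.sub_apply]
  rcases hij.lt_or_eq with hlt | heq
  · rw [hu.1 hlt, Matrix.one_apply, if_neg (ne_of_gt hlt), sub_zero]
  · subst heq; rw [hu.2 j, Matrix.one_apply_eq, sub_self]

end StrictUpper

/-! ### 2. Conjugation by `w⁰` and the sharp `X♯ = w⁰ ᵗX w⁰` -/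

section Weyl

/-- `(w⁰ M) i j = M (rev i) j`. [folklore] -/
theorem weylLong_mul_apply (M : Matrix (Fin n) (Fin n) R) (i j : Fin n) :
    (((weylLong n R : GL (Fin n) R) : Matrix (Fin n) (Fin n) R) * M) i j = M i.rev j := by
  rw [coe_weylLong, Equiv.Perm.permMatrix, PEquiv.toMatrix_toPEquiv_mul]
  rfl

/-- `(M w⁰) i j = M i (rev j)`. [folklore] -/
theorem mul_weylLong_apply (M : Matrix (Fin n) (Fin n) R) (i j : Fin n) :
    (M * ((weylLong n R : GL (Fin n) R) : Matrix (Fin n) (Fin n) R)) i j = M i j.rev := by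
  rw [coe_weylLong, Equiv.Perm.permMatrix, PEquiv.mul_toMatrix_toPEquiv]
  rfl

/-- `(w⁰ M w⁰) i j = M (rev i) (rev j)`. [folklore] -/
theorem weylLong_conj_apply (M : Matrix (Fin n) (Fin n) R) (i j : Fin n) :
    (((weylLong n R : GL (Fin n) R) : Matrix (Fin n) (Fin n) R) * M *
      ((weylLong n R : GL (Fin n) R) : Matrix (Fin n) (Fin n) R)) i j = M i.rev j.rev := by
  rw [mul_weylLong_apply, weylLong_mul_apply]

/-- `w⁰ w⁰ = 1` (as matrices). [folklore] -/
theorem weylLong_mul_weylLong :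
    ((weylLong n R : GL (Fin n) R) : Matrix (Fin n) (Fin n) R) * ((weylLong n R : GL (Fin n) R) : Matrix (Fin n) (Fin n) R) = 1 := by
  have h : (weylLong n R) * (weylLong n R)⁻¹ = 1 := mul_inv_cancel _
  rw [weylLong_inv] at h
  have h' := congrArg (fun g : GL (Fin n) R => (g : Matrix (Fin n) (Fin n) R)) h
  simpa only [Units.val_mul, Units.val_one] using h'


/-- `ᵗw⁰ = w⁰` (the reversal is an involution). [folklore] -/
theorem weylLong_transpose :
    (((weylLong n R : GL (Fin n) R) : Matrix (Fin n) (Fin n) R))ᵀ = ((weylLong n R : GL (Fin n) R) : Matrix (Fin n) (Fin n) R) := by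
  rw [coe_weylLong, Equiv.Perm.permMatrix, ← PEquiv.toMatrix_symm, ← Equiv.toPEquiv_symm, Fin.revPerm_symm]

/-- **The sharp `X♯ = w⁰ ᵗX w⁰`**, `X♯ i j = X (rev j) (rev i)`. [folklore] -/
def weylSharp (X : Matrix (Fin n) (Fin n) R) : Matrix (Fin n) (Fin n) R :=
  ((weylLong n R : GL (Fin n) R) : Matrix (Fin n) (Fin n) R) * Xᵀ * ((weylLong n R : GL (Fin n) R) : Matrix (Fin n) (Fin n) R)

/-- Entries of `X♯`. [folklore] -/
theorem weylSharp_apply (X : Matrix (Fin n) (Fin n) R) (i j : Fin n) : weylSharp X i j = X j.rev i.rev := by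
  rw [weylSharp, weylLong_conj_apply, transpose_apply]

/-- `X♯♯ = X`. [folklore] -/
theorem weylSharp_weylSharp (X : Matrix (Fin n) (Fin n) R) : weylSharp (weylSharp X) = X := by
  ext i j; simp only [weylSharp_apply, Fin.rev_rev]

/-- `X♯` is strictly upper when `X` is. [folklore] -/
theorem weylSharp_mem_strictUpper {X : Matrix (Fin n) (Fin n) R} (hX : X ∈ strictUpper n R) :
    weylSharp X ∈ strictUpper n R := fun i j hij => by
  rw [weylSharp_apply]
  exact hX _ _ (Fin.rev_le_rev.2 hij)

/-- `X ↦ X♯` is additive. [folklore] -/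
theorem weylSharp_add (X Y : Matrix (Fin n) (Fin n) R) : weylSharp (X + Y) = weylSharp X + weylSharp Y := by
  ext i j; simp only [weylSharp_apply, Matrix.add_apply]

/-- `X ↦ X♯` is homogeneous. [folklore] -/
theorem weylSharp_smul {S : Type*} [SMul S R] (c : S) (X : Matrix (Fin n) (Fin n) R) :
    weylSharp (c • X) = c • weylSharp X := by
  ext i j; simp only [weylSharp_apply, Matrix.smul_apply]

/-- `1♯ = 1`. [folklore] -/
theorem weylSharp_one : weylSharp (1 : Matrix (Fin n) (Fin n) R) = 1 := by
  ext i j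
  simp only [weylSharp_apply, one_apply, Fin.rev_inj, eq_comm]

/-- `(X Y)♯ = Y♯ X♯`. [folklore] -/
theorem weylSharp_mul (X Y : Matrix (Fin n) (Fin n) R) : weylSharp (X * Y) = weylSharp Y * weylSharp X := by
  ext i j
  simp only [weylSharp_apply, mul_apply]
  rw [← Equiv.sum_comp Fin.revPerm]
  refine Finset.sum_congr rfl fun k _ => ?_
  simp only [Fin.revPerm_apply, mul_comm]

end Weyl

/-! ### 3. The chart of the big cell and the uniqueness of the Bruhat decomposition -/

section BigCell

/-- **The chart of the big cell**: `Ψ(X₁, a, X₂) = (1 + X₁) w⁰ diag(a) (1 + X₂)`. [folklore] -/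
def bigCellMap (X₁ : Matrix (Fin n) (Fin n) R) (a : Fin n → R) (X₂ : Matrix (Fin n) (Fin n) R) :
    Matrix (Fin n) (Fin n) R :=
  (1 + X₁) * ((weylLong n R : GL (Fin n) R) : Matrix (Fin n) (Fin n) R) * diagonal a * (1 + X₂)

/-- The invertible diagonal matrix of a family of units. [folklore] -/
noncomputable def diagUnitsGL (a : Fin n → R) (ha : ∀ i, IsUnit (a i)) : GL (Fin n) R :=
  ⟨diagonal a, diagonal fun i => ((ha i).unit⁻¹ : Rˣ), by
    rw [diagonal_mul_diagonal, ← diagonal_one]; congr 1; funext i; exact (ha i).mul_val_inv, by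
    rw [diagonal_mul_diagonal, ← diagonal_one]; congr 1; funext i; exact (ha i).val_inv_mul⟩

/-- The matrix of `diagUnitsGL a`. [folklore] -/
@[simp] theorem coe_diagUnitsGL (a : Fin n → R) (ha : ∀ i, IsUnit (a i)) :
    ((diagUnitsGL a ha : GL (Fin n) R) : Matrix (Fin n) (Fin n) R) = diagonal a := rfl

/-- The chart lands in `GL_n(R)` for strictly upper `X₁, X₂` and unit `a`:
`Ψ(X₁, a, X₂) = unitri X₁ · w⁰ · diag a · unitri X₂`. [folklore] -/
theorem bigCellMap_eq_coe {X₁ X₂ : Matrix (Fin n) (Fin n) R} (h₁ : X₁ ∈ strictUpper n R) (h₂ : X₂ ∈ strictUpper n R)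
    {a : Fin n → R} (ha : ∀ i, IsUnit (a i)) :
    bigCellMap X₁ a X₂ = ((unitri X₁ h₁ * weylLong n R * diagUnitsGL a ha * unitri X₂ h₂ : GL (Fin n) R) :
      Matrix (Fin n) (Fin n) R) := by
  simp only [bigCellMap, Units.val_mul, coe_unitri, coe_diagUnitsGL]

/-- **Uniqueness in the big cell**: if `w⁰ U w⁰ = D' V D⁻¹` with `U, V` upper unitriangular and
`D = diag a`, `D' = diag a'` invertible diagonal, then `U = 1`, `V = 1` and `a = a'` (`w⁰ U w⁰` is lower
unitriangular, `D' V D⁻¹` is upper triangular with diagonal `a' a⁻¹`). [folklore] -/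
theorem bruhat_bigCell_unique_aux {U V : GL (Fin n) R} (hU : U ∈ upperUnitriangular (Fin n) R)
    (hV : V ∈ upperUnitriangular (Fin n) R) {a a' : Fin n → R} (ha : ∀ i, IsUnit (a i)) (ha' : ∀ i, IsUnit (a' i))
    (h : weylLong n R * U * weylLong n R = diagUnitsGL a' ha' * V * (diagUnitsGL a ha)⁻¹) :
    U = 1 ∧ V = 1 ∧ a = a' := by
  rw [mem_upperUnitriangular_iff] at hU hV
  have hcoeinv : (((diagUnitsGL a ha)⁻¹ : GL (Fin n) R) : Matrix (Fin n) (Fin n) R) =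
      diagonal fun i => (((ha i).unit⁻¹ : Rˣ) : R) := rfl
  -- entries of the two sides
  have hent : ∀ i j : Fin n, (U : Matrix (Fin n) (Fin n) R) i.rev j.rev =
      a' i * (V : Matrix (Fin n) (Fin n) R) i j * (((ha j).unit⁻¹ : Rˣ) : R) := by
    intro i j
    have h1 := congrArg (fun g : GL (Fin n) R => (g : Matrix (Fin n) (Fin n) R) i j) h
    simp only [Units.val_mul] at h1
    rw [weylLong_conj_apply, hcoeinv, coe_diagUnitsGL, mul_diagonal, diagonal_mul] at h1
    exact h1
  -- the left side is lower unitriangular, the right side upper triangular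
  have hVoff : ∀ i j : Fin n, i ≠ j → (V : Matrix (Fin n) (Fin n) R) i j = 0 := by
    intro i j hij
    rcases lt_or_gt_of_ne hij with hlt | hgt
    · -- `i < j`: the left side vanishes (`rev j < rev i`)
      have h1 := hent i j
      rw [hU.1 (show (id j.rev) < id i.rev from Fin.rev_lt_rev.2 hlt)] at h1
      -- `0 = a' i * V i j * (a j)⁻¹` with units `a' i`, `(a j)⁻¹`
      have h2 : a' i * (V : Matrix (Fin n) (Fin n) R) i j * (((ha j).unit⁻¹ : Rˣ) : R) * a j = 0 := by
        rw [← h1, zero_mul]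
      rw [mul_assoc, show ((((ha j).unit⁻¹ : Rˣ) : R)) * a j = 1 from (ha j).val_inv_mul, mul_one] at h2
      have h3 := congrArg (fun x => (((ha' i).unit⁻¹ : Rˣ) : R) * x) h2
      simp only [mul_zero, ← mul_assoc] at h3
      rwa [show ((((ha' i).unit⁻¹ : Rˣ) : R)) * a' i = 1 from (ha' i).val_inv_mul, one_mul] at h3
    · exact hV.1 hgt
  have hdiag : ∀ i : Fin n, a i = a' i := by
    intro i
    have h1 := hent i i
    rw [hU.2, hV.2, mul_one] at h1
    -- `1 = a' i * (a i)⁻¹`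
    have h2 := congrArg (fun x => x * a i) h1
    simp only [one_mul, mul_assoc] at h2
    rw [show ((((ha i).unit⁻¹ : Rˣ) : R)) * a i = 1 from (ha i).val_inv_mul, mul_one] at h2
    exact h2
  have hV1 : V = 1 := by
    refine Units.ext (Matrix.ext fun i j => ?_)
    rw [Units.val_one, one_apply]
    by_cases hij : i = j
    · subst hij; rw [if_pos rfl]; exact hV.2 i
    · rw [if_neg hij]; exact hVoff i j hij
  have hU1 : U = 1 := by
    refine Units.ext (Matrix.ext fun i j => ?_)
    rw [Units.val_one, one_apply]
    have h1 := hent i.rev j.rev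
    simp only [Fin.rev_rev] at h1
    rw [h1, hV1, Units.val_one, one_apply]
    by_cases hij : i = j
    · subst hij
      simp only [if_true, mul_one, ← hdiag]
      exact (ha i.rev).mul_val_inv
    · have : i.rev ≠ j.rev := fun h' => hij (Fin.rev_injective h')
      rw [if_neg this, if_neg hij, mul_zero, zero_mul]
  exact ⟨hU1, hV1, funext hdiag⟩

/-- **Uniqueness of the Bruhat decomposition in the big cell** over a commutative ring:
`(1 + X₁) w⁰ diag(a) (1 + X₂) = (1 + X₁') w⁰ diag(a') (1 + X₂')` with strictly upper `X`'s and unit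
diagonals forces `X₁ = X₁'`, `a = a'`, `X₂ = X₂'`. [cite: Bump1997, §4.4 (proof of Thm. 4.4.2, the big cell)] -/
theorem bigCellMap_injective {X₁ X₁' X₂ X₂' : Matrix (Fin n) (Fin n) R}
    (h₁ : X₁ ∈ strictUpper n R) (h₁' : X₁' ∈ strictUpper n R) (h₂ : X₂ ∈ strictUpper n R) (h₂' : X₂' ∈ strictUpper n R)
    {a a' : Fin n → R} (ha : ∀ i, IsUnit (a i)) (ha' : ∀ i, IsUnit (a' i))
    (h : bigCellMap X₁ a X₂ = bigCellMap X₁' a' X₂') : X₁ = X₁' ∧ a = a' ∧ X₂ = X₂' := by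
  rw [bigCellMap_eq_coe h₁ h₂ ha, bigCellMap_eq_coe h₁' h₂' ha'] at h
  have hGL : unitri X₁ h₁ * weylLong n R * diagUnitsGL a ha * unitri X₂ h₂ =
      unitri X₁' h₁' * weylLong n R * diagUnitsGL a' ha' * unitri X₂' h₂' := Units.ext h
  -- `U = (1 + X₁')⁻¹ (1 + X₁)`, `V = (1 + X₂') (1 + X₂)⁻¹`
  set U : GL (Fin n) R := (unitri X₁' h₁')⁻¹ * unitri X₁ h₁ with hUdef
  set V : GL (Fin n) R := unitri X₂' h₂' * (unitri X₂ h₂)⁻¹ with hVdef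
  have hU : U ∈ upperUnitriangular (Fin n) R :=
    Subgroup.mul_mem _ (Subgroup.inv_mem _ (unitri_mem_upperUnitriangular X₁' h₁')) (unitri_mem_upperUnitriangular X₁ h₁)
  have hV : V ∈ upperUnitriangular (Fin n) R :=
    Subgroup.mul_mem _ (unitri_mem_upperUnitriangular X₂' h₂') (Subgroup.inv_mem _ (unitri_mem_upperUnitriangular X₂ h₂))
  have hw : (weylLong n R)⁻¹ = weylLong n R := weylLong_inv n R
  have hkey : weylLong n R * U * weylLong n R = diagUnitsGL a' ha' * V * (diagUnitsGL a ha)⁻¹ := by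
    -- from `u₁ w d u₂ = u₁' w d' u₂'`: `w⁻¹ u₁'⁻¹ u₁ w = d' u₂' u₂⁻¹ d⁻¹`
    have h1 : (unitri X₁' h₁')⁻¹ * unitri X₁ h₁ * weylLong n R * diagUnitsGL a ha * unitri X₂ h₂ =
        weylLong n R * diagUnitsGL a' ha' * unitri X₂' h₂' := by
      have h2 := congrArg (fun g => (unitri X₁' h₁')⁻¹ * g) hGL
      simp only [← mul_assoc, inv_mul_cancel, one_mul] at h2
      simpa only [← mul_assoc] using h2
    have h3 := congrArg (fun g => (weylLong n R)⁻¹ * g * (unitri X₂ h₂)⁻¹ * (diagUnitsGL a ha)⁻¹) h1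
    simp only [mul_assoc, mul_inv_cancel, mul_one] at h3
    simp only [← mul_assoc, inv_mul_cancel, one_mul] at h3
    rw [hw] at h3
    rw [hUdef, hVdef]
    simpa only [← mul_assoc, mul_inv_cancel_right] using h3
  obtain ⟨hU1, hV1, haa⟩ := bruhat_bigCell_unique_aux hU hV ha ha' hkey
  refine ⟨?_, haa, ?_⟩
  · have h1 : unitri X₁ h₁ = unitri X₁' h₁' := by
      have h2 := congrArg (fun g => unitri X₁' h₁' * g) hU1
      simpa only [hUdef, ← mul_assoc, mul_inv_cancel, one_mul, mul_one] using h2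
    have h3 := congrArg (fun g : GL (Fin n) R => (g : Matrix (Fin n) (Fin n) R)) h1
    simpa only [coe_unitri, add_right_inj] using h3
  · have h1 : unitri X₂' h₂' = unitri X₂ h₂ := by
      have h2 := congrArg (fun g => g * unitri X₂ h₂) hV1
      simpa only [hVdef, mul_assoc, inv_mul_cancel, one_mul, mul_one] using h2
    have h3 := congrArg (fun g : GL (Fin n) R => (g : Matrix (Fin n) (Fin n) R)) h1
    have h4 : X₂' = X₂ := by simpa only [coe_unitri, add_right_inj] using h3
    exact h4.symm

/-- **The Gelfand–Kazhdan involution in the coordinates of the big cell**: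
`ι((1 + X₁) w⁰ diag(a) (1 + X₂)) = (1 + X₂♯) w⁰ diag(a) (1 + X₁♯)`, `ι(g) = w⁰ ᵗg w⁰`, `X♯ = w⁰ ᵗX w⁰`.
[cite: Shalika1974, §2] -/
theorem weylLong_transpose_bigCellMap_weylLong (X₁ X₂ : Matrix (Fin n) (Fin n) R) (a : Fin n → R) :
    ((weylLong n R : GL (Fin n) R) : Matrix (Fin n) (Fin n) R) * (bigCellMap X₁ a X₂)ᵀ *
        ((weylLong n R : GL (Fin n) R) : Matrix (Fin n) (Fin n) R) =
      bigCellMap (weylSharp X₂) a (weylSharp X₁) := by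
  set w : Matrix (Fin n) (Fin n) R := ((weylLong n R : GL (Fin n) R) : Matrix (Fin n) (Fin n) R) with hw
  have hww : w * w = 1 := weylLong_mul_weylLong
  simp only [bigCellMap, transpose_mul, transpose_add, transpose_one, diagonal_transpose, weylLong_transpose]
  rw [← hw]
  -- `w (1 + ᵗX₂) d w (1 + ᵗX₁) w = (1 + X₂♯) w d (1 + X₁♯)` with `X♯ = w ᵗX w`, using `w w = 1`
  have hs : ∀ X : Matrix (Fin n) (Fin n) R, 1 + weylSharp X = w * (1 + Xᵀ) * w := by
    intro X
    rw [weylSharp, ← hw, mul_add, add_mul, mul_one, hww]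
  rw [hs X₂, hs X₁]
  simp only [Matrix.mul_assoc]
  congr 2
  rw [← Matrix.mul_assoc w (diagonal a), ← Matrix.mul_assoc w (w * diagonal a), ← Matrix.mul_assoc w w, hww,
    Matrix.one_mul]

end BigCell


end Literature.NumberTheory.Automorphic
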